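import Literature.NumberTheory.Sieve.DrappeauDispersion
import Literature.NumberTheory.Sieve.DrappeauTopacogullariProofs
import Literature.NumberTheory.Sieve.MatomakiRadziwillLemma13
import Mathlib.NumberTheory.DirichletCharacter.Bounds
import Mathlib.NumberTheory.EulerProduct.Basic
import Mathlib.NumberTheory.SmoothNumbers
import HarnessLib

/-!
# Drappeau 2017, §5: elementary lemmas around the conductor-truncated kernel `𝔲_R` — proved

Companion (theorems only, everything PROVED) of `Literature.NumberTheory.Sieve.DrappeauDispersion`, which
defines Drappeau's kernel `𝔲_R(t; d) = φ(d)⁻¹ ∑_{χ mod d, cond χ > R} χ(t)` (`Drappeau2017.uR`), its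
complement `mainKernel`, and vendors Theorem 5.1 of S. Drappeau, *Sums of Kloosterman sums in arithmetic
progressions, and the error term in the dispersion method*, Proc. London Math. Soc. (3) 114 (2017)
684–732 = arXiv:1504.05549 (held as `paper:arxiv-1504.05549`, §5 read on chunk 17).

These are the bricks used to APPLY Theorem 5.1 to a bilinear sum with extra class conditions (the
"peel" of the Parity route `LiouvilleShiftedTables`, crux `TypeI2Dilated`), all classical:

* `norm_uR_le` — the printed trivial bound (5.2): `|𝔲_R(n; q)| ≤ 1_{n ≡ 1 (q)} + R τ(q)/φ(q)` (with
  constant `1`; from `#{χ mod q : cond χ ≤ R} ≤ R τ(q)`, tree lemma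
  `DrappeauTopacogullari2019.card_filter_conductor_le`), and `card_univ_dirichletCharacter` (`#{χ mod q} = φ(q)`).
* `indicator_eq_sum_char` — orthogonality for a unit class: `1_{k ≡ a (L)} = φ(L)⁻¹ ∑_ξ ξ(ā) ξ(k)`.
* `crt_reduce`, `natCast_eq_iff_gcd_dvd`, `coprime_div_gcd_div_gcd'` — CRT for two possibly non-coprime
  moduli, and the reduction of a class `e mod L` to `g ∣ k`, `k/g ≡ e/g (mod L/g)` with `g = (e, L)`.
* `zmod_mul_inv_of_isUnit` — `(ab)⁻¹ = a⁻¹ b⁻¹` for units of `ZMod n`.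
* `mul_mem_dyadic_iff`, `card_dyadic_le`, `le_floor_of_mem_dyadic` — the dyadic ranges `BFI.dyadic`.
* `coprime_of_primeFactors_subset`, `coprime_div_sPart`, `sPart_mul_eq_self`,
  `sum_dyadic_eq_sum_filter_primeFactors` — sorting `n ∼ N` by its `P^∞`-part `h = s_P(n)`
  (`MatomakiRadziwillL13.sPart`): `∑_{n ∼ N} G(n) = ∑_{h ∣ P^∞} ∑_{n'' ∼ N/h, (n'', P) = 1} G(h n'')`.
* `sum_rpow_neg_half_le`, `two_pow_card_primeFactors_le`, `sum_filter_primeFactors_rpow_le` — the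
  Rankin/Euler-product bound `∑_{h ∣ P^∞} h^{-1/2} ≤ 4^{ω(P)} ≤ τ(P)²`.

Not here: Theorem 5.1 itself (a named fact in the base file).

## References

* S. Drappeau, Proc. London Math. Soc. (3) 114 (2017) 684–732, arXiv:1504.05549, §5 (5.1)–(5.2), Theorem 5.1.
  [Drappeau2017]
-/

open Finset Real
open scoped ArithmeticFunction.sigma

noncomputable section

namespace Literature.NumberTheory.Sieve

namespace Drappeau2017

/-! ### CRT and the `g`-reduction of a class -/

/-- **CRT for two possibly non-coprime moduli**: the pair of classes `(a mod r, b mod q)` is either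
never hit by a natural number, or it is a single class `e mod lcm(q, r)`. [folklore] -/
theorem crt_reduce {q r : ℕ} (a b : ℤ) :
    (∀ k : ℕ, ¬ (((k : ℕ) : ZMod r) = ((a : ℤ) : ZMod r) ∧ ((k : ℕ) : ZMod q) = ((b : ℤ) : ZMod q))) ∨
    ∃ e : ℕ, ∀ k : ℕ,
      ((((k : ℕ) : ZMod r) = ((a : ℤ) : ZMod r) ∧ ((k : ℕ) : ZMod q) = ((b : ℤ) : ZMod q)) ↔
        ((k : ℕ) : ZMod (Nat.lcm q r)) = ((e : ℕ) : ZMod (Nat.lcm q r))) := by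
  by_cases h : ∃ k₀ : ℕ, ((k₀ : ℕ) : ZMod r) = ((a : ℤ) : ZMod r) ∧ ((k₀ : ℕ) : ZMod q) = ((b : ℤ) : ZMod q)
  · obtain ⟨k₀, hk₀r, hk₀q⟩ := h
    refine Or.inr ⟨k₀, fun k => ?_⟩
    rw [← hk₀r, ← hk₀q, ZMod.natCast_eq_natCast_iff, ZMod.natCast_eq_natCast_iff,
      ZMod.natCast_eq_natCast_iff]
    simp only [Nat.modEq_iff_dvd, Int.natCast_dvd]
    rw [Nat.lcm_dvd_iff, and_comm]
  · push Not at h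
    exact Or.inl fun k hk => h k hk.1 hk.2

/-- **The `g`-reduction of a class**: with `g = (e, L)`, `k ≡ e (mod L)` iff `g ∣ k` and
`k/g ≡ e/g (mod L/g)` (and `e/g` is then a unit `mod L/g`). [folklore] -/
theorem natCast_eq_iff_gcd_dvd {e L : ℕ} (hL : 0 < L) (k : ℕ) :
    ((k : ZMod L) = (e : ZMod L)) ↔
      Nat.gcd e L ∣ k ∧ ((k / Nat.gcd e L : ℕ) : ZMod (L / Nat.gcd e L)) =
        ((e / Nat.gcd e L : ℕ) : ZMod (L / Nat.gcd e L)) := by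
  set g := Nat.gcd e L with hg
  have hg0 : 0 < g := Nat.gcd_pos_of_pos_right _ hL
  obtain ⟨e', he'⟩ : g ∣ e := Nat.gcd_dvd_left e L
  obtain ⟨L', hL'⟩ : g ∣ L := Nat.gcd_dvd_right e L
  have he'd : e / g = e' := by rw [he', Nat.mul_div_cancel_left _ hg0]
  have hL'd : L / g = L' := by rw [hL', Nat.mul_div_cancel_left _ hg0]
  rw [he'd, hL'd, ZMod.natCast_eq_natCast_iff, ZMod.natCast_eq_natCast_iff]
  constructor
  · intro h
    have hgk : g ∣ k := by
      have h1 : k ≡ e [MOD g] := Nat.ModEq.of_dvd ⟨L', hL'⟩ h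
      have h2 : e ≡ 0 [MOD g] := Nat.modEq_zero_iff_dvd.2 ⟨e', he'⟩
      exact Nat.modEq_zero_iff_dvd.1 (h1.trans h2)
    obtain ⟨k', rfl⟩ := hgk
    refine ⟨dvd_mul_right g k', ?_⟩
    rw [Nat.mul_div_cancel_left _ hg0]
    rw [he', hL'] at h
    exact Nat.ModEq.mul_left_cancel' hg0.ne' h
  · rintro ⟨⟨k', rfl⟩, h⟩
    rw [Nat.mul_div_cancel_left _ hg0] at h
    rw [he', hL']
    exact Nat.ModEq.mul_left' g h

/-- `e/g` is coprime to `L/g` for `g = (e, L)`, `L ≥ 1`. [folklore] -/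
theorem coprime_div_gcd_div_gcd' {e L : ℕ} (hL : 0 < L) :
    (e / Nat.gcd e L).Coprime (L / Nat.gcd e L) :=
  Nat.coprime_div_gcd_div_gcd (Nat.gcd_pos_of_pos_right _ hL)

/-! ### Characters: counting, orthogonality, the trivial bound (5.2) -/

/-- The number of Dirichlet characters `mod L` (as a `Finset.univ` cardinality) is `φ(L)`. [folklore] -/
theorem card_univ_dirichletCharacter {L : ℕ} (hL : 0 < L) :
    (Finset.univ : Finset (DirichletCharacter ℂ L)).card = Nat.totient L := by
  haveI : NeZero L := ⟨hL.ne'⟩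
  haveI : NeZero ((Monoid.exponent (ZMod L)ˣ : ℕ) : ℂ) :=
    ⟨Nat.cast_ne_zero.mpr Monoid.exponent_ne_zero_of_finite⟩
  rw [Finset.card_univ, ← Nat.card_eq_fintype_card]
  exact DirichletCharacter.card_eq_totient_of_hasEnoughRootsOfUnity ℂ L

/-- **Character expansion of a unit class** (orthogonality): for `(a, L) = 1`,
`1_{k ≡ a (L)} = φ(L)⁻¹ ∑_{ξ mod L} ξ(ā) ξ(k)`. [folklore] -/
theorem indicator_eq_sum_char {L : ℕ} (hL : 0 < L) {a : ℕ} (ha : a.Coprime L) (k : ℕ) :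
    (if ((k : ZMod L) = (a : ZMod L)) then (1 : ℂ) else 0) =
      ((Nat.totient L : ℂ))⁻¹ *
        ∑ ξ : DirichletCharacter ℂ L, ξ ((a : ZMod L))⁻¹ * ξ (k : ZMod L) := by
  haveI : NeZero L := ⟨hL.ne'⟩
  haveI : NeZero ((Monoid.exponent (ZMod L)ˣ : ℕ) : ℂ) :=
    ⟨Nat.cast_ne_zero.mpr Monoid.exponent_ne_zero_of_finite⟩
  have hu : IsUnit (a : ZMod L) := (ZMod.isUnit_iff_coprime a L).2 ha
  rw [DirichletCharacter.sum_char_inv_mul_char_eq ℂ hu]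
  have hφ : (Nat.totient L : ℂ) ≠ 0 := by exact_mod_cast (Nat.totient_pos.2 hL).ne'
  by_cases h : (k : ZMod L) = (a : ZMod L)
  · rw [if_pos h, if_pos h.symm, inv_mul_cancel₀ hφ]
  · rw [if_neg h, if_neg (Ne.symm h), mul_zero]

/-- **Drappeau's trivial bound (5.2)** "`|𝔲_R(n; q)| ≪ 1_{n ≡ 1 (q)} + R τ(q)/φ(q)`", here with
constant `1`: `|𝔲_R(t; s)| ≤ 1_{t = 1} + R τ(s)/φ(s)` for `s ≥ 1`, `R ≥ 0` (orthogonality and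
`#{χ mod s : cond χ ≤ R} ≤ R τ(s)`).
[cite: Drappeau2017, §5 (5.2)] -/
theorem norm_uR_le {s : ℕ} (hs : 0 < s) {Rd : ℝ} (hRd : 0 ≤ Rd) (t : ZMod s) :
    ‖uR Rd s t‖ ≤ (if t = 1 then 1 else 0) + Rd * (σ 0 s : ℝ) / (Nat.totient s : ℝ) := by
  haveI : NeZero s := ⟨hs.ne'⟩
  have h := mainKernel_add_uR_eq_ite Rd t
  have huR : uR Rd s t = (if t = 1 then 1 else 0) - mainKernel Rd s t := by
    rw [← h]; ring
  rw [huR]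
  refine (norm_sub_le _ _).trans (add_le_add ?_ ?_)
  · split_ifs <;> simp
  · unfold mainKernel
    rw [norm_mul, norm_inv, Complex.norm_natCast, ← Finset.sum_filter]
    have hφ : (0 : ℝ) < Nat.totient s := by exact_mod_cast Nat.totient_pos.2 hs
    have hcard := DrappeauTopacogullari2019.card_filter_conductor_le hs hRd
    have hnorm : ‖∑ χ ∈ (Finset.univ.filter fun χ : DirichletCharacter ℂ s => (χ.conductor : ℝ) ≤ Rd),
        χ t‖ ≤ ((Finset.univ.filter fun χ : DirichletCharacter ℂ s => (χ.conductor : ℝ) ≤ Rd).card : ℝ) := by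
      refine (norm_sum_le _ _).trans ?_
      refine (Finset.sum_le_sum fun χ _ => χ.norm_le_one t).trans ?_
      simp
    rw [ArithmeticFunction.sigma_zero_apply]
    calc (Nat.totient s : ℝ)⁻¹ * _ ≤ (Nat.totient s : ℝ)⁻¹ * (Rd * (Nat.divisors s).card) :=
          mul_le_mul_of_nonneg_left (hnorm.trans hcard) (inv_nonneg.2 hφ.le)
      _ = Rd * ((Nat.divisors s).card : ℝ) / (Nat.totient s : ℝ) := by
          rw [inv_mul_eq_div]

/-- `(ab)⁻¹ = a⁻¹ b⁻¹` for units of `ZMod n` (`ZMod.inv` agrees with the group inverse on units).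
[folklore] -/
theorem zmod_mul_inv_of_isUnit {n : ℕ} {a b : ZMod n} (ha : IsUnit a) (hb : IsUnit b) :
    (a * b)⁻¹ = a⁻¹ * b⁻¹ := by
  have h1 := ZMod.inv_mul_of_unit (a * b) (ha.mul hb)
  have h2 := ZMod.mul_inv_of_unit a ha
  have h3 := ZMod.mul_inv_of_unit b hb
  calc (a * b)⁻¹ = (a * b)⁻¹ * (a * a⁻¹) * (b * b⁻¹) := by rw [h2, h3, mul_one, mul_one]
    _ = (a * b)⁻¹ * (a * b) * (a⁻¹ * b⁻¹) := by ring
    _ = a⁻¹ * b⁻¹ := by rw [h1, one_mul]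

/-! ### Dyadic ranges -/

/-- Scaling a dyadic range: `d n ∼ M ⇔ n ∼ M/d` (`d ≥ 1`, `M ≥ 0`). [folklore] -/
theorem mul_mem_dyadic_iff {M : ℝ} (hM : 0 ≤ M) {d : ℕ} (hd : 0 < d) (n : ℕ) :
    d * n ∈ BFI.dyadic M ↔ n ∈ BFI.dyadic (M / d) := by
  have hd' : (0 : ℝ) < d := by exact_mod_cast hd
  rw [BFI.mem_dyadic hM, BFI.mem_dyadic (div_nonneg hM hd'.le), Nat.cast_mul,
    div_lt_iff₀' hd', show 2 * (M / d) = 2 * M / d by ring, le_div_iff₀' hd']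

/-- The size of a dyadic range: `#{m ∼ M} ≤ 2M` for `M ≥ 0`. [folklore] -/
theorem card_dyadic_le {M : ℝ} (hM : 0 ≤ M) : ((BFI.dyadic M).card : ℝ) ≤ 2 * M := by
  have h1 : (BFI.dyadic M).card ≤ ⌊2 * M⌋₊ := by
    unfold BFI.dyadic
    calc ((Finset.range (⌊2 * M⌋₊ + 1)).filter fun m : ℕ => M < m).card
        ≤ ((Finset.range (⌊2 * M⌋₊ + 1)).erase 0).card := by
          refine Finset.card_le_card fun m hm => ?_
          rw [Finset.mem_filter] at hm
          rw [Finset.mem_erase]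
          refine ⟨?_, hm.1⟩
          rintro rfl
          simp at hm
          linarith
      _ = ⌊2 * M⌋₊ := by rw [Finset.card_erase_of_mem (by simp), Finset.card_range]; rfl
  calc ((BFI.dyadic M).card : ℝ) ≤ ⌊2 * M⌋₊ := by exact_mod_cast h1
    _ ≤ 2 * M := Nat.floor_le (by linarith)

/-- Elements of `n ∼ N` are at most `⌊2N⌋₊`. [folklore] -/
theorem le_floor_of_mem_dyadic {N : ℝ} (hN : 0 ≤ N) {n : ℕ} (hn : n ∈ BFI.dyadic N) : n ≤ ⌊2 * N⌋₊ :=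
  Nat.le_floor ((BFI.mem_dyadic hN).1 hn).2

/-! ### Sorting `n ∼ N` by its `P^∞`-part -/

/-- `n` coprime to `P` is coprime to every `h` composed of primes of `P`. [folklore] -/
theorem coprime_of_primeFactors_subset {P h n : ℕ} (hh : h ≠ 0)
    (hhS : h.primeFactors ⊆ P.primeFactors) (hnP : n.Coprime P) : n.Coprime h := by
  refine Nat.coprime_of_dvd fun p hp hpn hph => ?_
  have hpP : p ∣ P := Nat.dvd_of_mem_primeFactors (hhS (Nat.mem_primeFactors.2 ⟨hp, hph, hh⟩))
  exact hp.one_lt.ne' ((Nat.Coprime.coprime_dvd_left hpn hnP).eq_one_of_dvd hpP)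

open MatomakiRadziwillL13 in
/-- The cofactor of the `P^∞`-part is coprime to `P`: `(n / s_P(n), P) = 1` (`P, n ≥ 1`,
`s_P = sPart (primeFactors P)`). [folklore] -/
theorem coprime_div_sPart {P n : ℕ} (hP : P ≠ 0) (hn : n ≠ 0) :
    (n / sPart P.primeFactors n).Coprime P := by
  set S := P.primeFactors with hSdef
  have hS : ∀ p ∈ S, p.Prime := fun p hp => Nat.prime_of_mem_primeFactors hp
  have hsp := sPart_dvd hS n
  have hsp0 := (sPart_pos hS n).ne'
  refine Nat.coprime_of_dvd fun p hp hpn hpP => ?_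
  have hpS : p ∈ S := Nat.mem_primeFactors.2 ⟨hp, hpP, hP⟩
  have h1 : p * sPart S n ∣ n := by
    calc p * sPart S n ∣ (n / sPart S n) * sPart S n := mul_dvd_mul_right hpn _
      _ = n := Nat.div_mul_cancel hsp
  have h2 : (p * sPart S n).primeFactors ⊆ S := by
    rw [Nat.primeFactors_mul hp.ne_zero hsp0, hp.primeFactors]
    exact Finset.union_subset (Finset.singleton_subset_iff.2 hpS) (primeFactors_sPart_subset hS n)
  have h3 := Nat.le_of_dvd (sPart_pos hS n) (dvd_sPart_of_dvd hn h1 h2)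
  have h4 : 2 * sPart S n ≤ p * sPart S n := Nat.mul_le_mul_right _ hp.two_le
  omega

open MatomakiRadziwillL13 in
/-- `s_P(h n) = h` when `h` is composed of primes of `P` and `(n, P) = 1`. [folklore] -/
theorem sPart_mul_eq_self {P h n : ℕ} (hh : h ≠ 0) (hhS : h.primeFactors ⊆ P.primeFactors)
    (hn : n ≠ 0) (hnP : n.Coprime P) : sPart P.primeFactors (h * n) = h := by
  set S := P.primeFactors with hSdef
  have hS : ∀ p ∈ S, p.Prime := fun p hp => Nat.prime_of_mem_primeFactors hp
  refine Nat.dvd_antisymm ?_ (dvd_sPart_of_dvd (mul_ne_zero hh hn) (dvd_mul_right h n) hhS)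
  have hcop : (sPart S (h * n)).Coprime n := by
    refine Nat.coprime_of_dvd fun p hp hps hpn => ?_
    have hpS : p ∈ S :=
      primeFactors_sPart_subset hS _ (Nat.mem_primeFactors.2 ⟨hp, hps, (sPart_pos hS _).ne'⟩)
    have hpP : p ∣ P := Nat.dvd_of_mem_primeFactors hpS
    exact hp.one_lt.ne' ((Nat.Coprime.coprime_dvd_left hpn hnP).eq_one_of_dvd hpP)
  exact hcop.dvd_of_dvd_mul_right (sPart_dvd hS _)

open MatomakiRadziwillL13 in
/-- **Sorting `n ∼ N` by its `P^∞`-part**: `∑_{n ∼ N} G(n) = ∑_{h ∣ P^∞, h ≤ B} ∑_{n'' ∼ N/h, (n'', P) = 1}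
G(h n'')` whenever `B ≥ 2N` (the map `n ↦ (s_P(n), n/s_P(n))` is a bijection). [folklore] -/
theorem sum_dyadic_eq_sum_filter_primeFactors {P : ℕ} (hP : P ≠ 0) {N : ℝ} (hN : 0 ≤ N) {B : ℕ} (hB : ⌊2 * N⌋₊ ≤ B)
    (G : ℕ → ℂ) :
    ∑ n ∈ BFI.dyadic N, G n =
      ∑ h ∈ (Icc 1 B).filter (fun h => h.primeFactors ⊆ P.primeFactors),
        ∑ n ∈ (BFI.dyadic (N / h)).filter (fun n => n.Coprime P), G (h * n) := by
  set S := P.primeFactors with hSdef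
  have hS : ∀ p ∈ S, p.Prime := fun p hp => Nat.prime_of_mem_primeFactors hp
  rw [Finset.sum_sigma']
  symm
  refine Finset.sum_bij' (fun x _ => x.1 * x.2) (fun n _ => ⟨sPart S n, n / sPart S n⟩) ?_ ?_ ?_ ?_ ?_
  · rintro ⟨h, n⟩ hx
    simp only [Finset.mem_sigma, Finset.mem_filter, Finset.mem_Icc] at hx
    obtain ⟨⟨⟨h1, -⟩, -⟩, hn, -⟩ := hx
    exact (mul_mem_dyadic_iff hN h1 n).2 hn
  · intro n hn
    have hn0 : n ≠ 0 := (BFI.pos_of_mem_dyadic hN hn).ne'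
    have hsp0 := sPart_pos hS n
    simp only [Finset.mem_sigma, Finset.mem_filter, Finset.mem_Icc]
    refine ⟨⟨⟨hsp0, ?_⟩, primeFactors_sPart_subset hS n⟩, ?_, coprime_div_sPart hP hn0⟩
    · exact ((sPart_le hS hn0).trans (le_floor_of_mem_dyadic hN hn)).trans hB
    · rw [← mul_mem_dyadic_iff hN hsp0, Nat.mul_div_cancel' (sPart_dvd hS n)]
      exact hn
  · rintro ⟨h, n⟩ hx
    simp only [Finset.mem_sigma, Finset.mem_filter, Finset.mem_Icc] at hx
    obtain ⟨⟨⟨h1, -⟩, hhS⟩, hn, hnP⟩ := hx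
    have hh0 : h ≠ 0 := by omega
    have hn0 : n ≠ 0 := (BFI.pos_of_mem_dyadic (div_nonneg hN (Nat.cast_nonneg _)) hn).ne'
    have e1 : sPart S (h * n) = h := sPart_mul_eq_self hh0 hhS hn0 hnP
    have e2 : h * n / sPart S (h * n) = n := by rw [e1, Nat.mul_div_cancel_left n (Nat.pos_of_ne_zero hh0)]
    exact Sigma.ext e1 (heq_of_eq e2)
  · intro n hn
    exact Nat.mul_div_cancel' (sPart_dvd hS n)
  · rintro ⟨h, n⟩ hx
    rfl

/-! ### The Rankin / Euler-product bound `∑_{h ∣ P^∞} h^{-1/2} ≤ 4^{ω(P)} ≤ τ(P)²` -/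

/-- **Rankin/Euler-product bound**: for a finite set `S` of primes and any finite set `R` of
`S`-factored numbers, `∑_{r ∈ R} r^{-1/2} ≤ 4^{#S}` (`∑ ≤ ∏_{p ∈ S} (1 − p^{-1/2})⁻¹` and
`(1 − 2^{-1/2})⁻¹ ≤ 4`). [folklore] -/
theorem sum_rpow_neg_half_le {S : Finset ℕ} (hS : ∀ p ∈ S, p.Prime) (R : Finset ℕ)
    (hR : ∀ r ∈ R, r ≠ 0 ∧ r.primeFactors ⊆ S) :
    ∑ r ∈ R, (r : ℝ) ^ (-(1 / 2 : ℝ)) ≤ 4 ^ S.card := by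
  -- adapted from Literature/NumberTheory/Sieve/MatomakiRadziwillLemma13.lean (`sum_wt_le`)
  classical
  set f : ℕ → ℝ := fun n => (n : ℝ) ^ (-(1 / 2 : ℝ)) with hf
  have hf1 : f 1 = 1 := by simp [hf]
  have hfmul : ∀ {m n : ℕ}, m.Coprime n → f (m * n) = f m * f n := by
    intro m n _
    simp only [hf, Nat.cast_mul]
    exact Real.mul_rpow (Nat.cast_nonneg _) (Nat.cast_nonneg _)
  have hpow : ∀ p n : ℕ, f (p ^ n) = ((p : ℝ) ^ (-(1 / 2 : ℝ))) ^ n := by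
    intro p n
    simp only [hf, Nat.cast_pow]
    rw [← Real.rpow_natCast ((p : ℝ) ^ (-(1 / 2 : ℝ))), ← Real.rpow_mul (Nat.cast_nonneg _),
      mul_comm, Real.rpow_mul (Nat.cast_nonneg _), Real.rpow_natCast]
  have hratio : ∀ {p : ℕ}, p.Prime → 0 ≤ (p : ℝ) ^ (-(1 / 2 : ℝ)) ∧ (p : ℝ) ^ (-(1 / 2 : ℝ)) ≤ 3 / 4 := by
    intro p hp
    refine ⟨by positivity, ?_⟩
    have hp2 : (2 : ℝ) ≤ p := by exact_mod_cast hp.two_le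
    calc (p : ℝ) ^ (-(1 / 2 : ℝ)) ≤ (2 : ℝ) ^ (-(1 / 2 : ℝ)) :=
          Real.rpow_le_rpow_of_nonpos (by norm_num) hp2 (by norm_num)
      _ ≤ 3 / 4 := by
          rw [Real.rpow_neg (by norm_num : (0 : ℝ) ≤ 2), ← Real.sqrt_eq_rpow,
            inv_le_comm₀ (by positivity) (by norm_num), Real.le_sqrt (by norm_num) (by norm_num)]
          norm_num
  have hsum : ∀ {p : ℕ}, p.Prime → Summable fun n : ℕ => ‖f (p ^ n)‖ := by
    intro p hp
    obtain ⟨h0, h34⟩ := hratio hp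
    have : (fun n : ℕ => ‖f (p ^ n)‖) = fun n : ℕ => ((p : ℝ) ^ (-(1 / 2 : ℝ))) ^ n := by
      funext n
      rw [hpow, Real.norm_of_nonneg (pow_nonneg h0 n)]
    rw [this]
    exact summable_geometric_of_lt_one h0 (by linarith)
  have hE := EulerProduct.summable_and_hasSum_factoredNumbers_prod_filter_prime_tsum
    (f := f) hf1 (fun h => hfmul h) (fun hp => hsum hp) S
  have hfilter : S.filter Nat.Prime = S := Finset.filter_true_of_mem hS
  rw [hfilter] at hE
  set R' : Finset (Nat.factoredNumbers S) := R.attach.map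
    ⟨fun r => ⟨r.1, Nat.mem_factoredNumbers_iff_primeFactors_subset.2 (hR r.1 r.2)⟩,
      fun a b h => Subtype.ext (by
        have := congrArg Subtype.val h; simpa using this)⟩ with hR'
  have hsumR : ∑ r ∈ R, f r = ∑ m ∈ R', f (m : ℕ) := by
    rw [hR', Finset.sum_map, ← Finset.sum_attach R]
    rfl
  have hfnn : ∀ n : ℕ, 0 ≤ f n := fun n => by simp only [hf]; positivity
  have hle : ∑ m ∈ R', f (m : ℕ) ≤ ∏ p ∈ S, ∑' ν : ℕ, f (p ^ ν) :=
    sum_le_hasSum R' (fun m _ => hfnn _) hE.2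
  have hfac : ∀ p ∈ S, ∑' ν : ℕ, f (p ^ ν) ≤ 4 := by
    intro p hp
    obtain ⟨h0, h34⟩ := hratio (hS p hp)
    rw [show (fun ν : ℕ => f (p ^ ν)) = fun ν : ℕ => ((p : ℝ) ^ (-(1 / 2 : ℝ))) ^ ν from
      funext fun ν => hpow p ν, tsum_geometric_of_lt_one h0 (by linarith)]
    rw [inv_le_comm₀ (by linarith) (by norm_num)]
    linarith
  have hfac0 : ∀ p ∈ S, 0 ≤ ∑' ν : ℕ, f (p ^ ν) := fun p _ => tsum_nonneg fun ν => hfnn _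
  calc ∑ r ∈ R, f r = ∑ m ∈ R', f (m : ℕ) := hsumR
    _ ≤ ∏ p ∈ S, ∑' ν : ℕ, f (p ^ ν) := hle
    _ ≤ ∏ p ∈ S, (4 : ℝ) := Finset.prod_le_prod hfac0 hfac
    _ = 4 ^ S.card := Finset.prod_const _

/-- `2^{ω(n)} ≤ τ(n)` for `n ≥ 1` (`τ(n) = ∏_{p ∣ n} (v_p(n) + 1)`). [folklore] -/
theorem two_pow_card_primeFactors_le {n : ℕ} (hn : n ≠ 0) : 2 ^ n.primeFactors.card ≤ σ 0 n := by
  rw [ArithmeticFunction.sigma_zero_apply, Nat.card_divisors hn, ← Finset.prod_const]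
  refine Finset.prod_le_prod' fun p hp => ?_
  have : 0 < n.factorization p :=
    (Nat.prime_of_mem_primeFactors hp).factorization_pos_of_dvd hn (Nat.dvd_of_mem_primeFactors hp)
  omega

/-- **The `h`-sums are harmless**: `∑_{h ≤ B, h ∣ P^∞} h^{-1/2} ≤ τ(P)²` for `P ≥ 1`. [folklore] -/
theorem sum_filter_primeFactors_rpow_le {P : ℕ} (hP : P ≠ 0) (B : ℕ) :
    ∑ h ∈ (Icc 1 B).filter (fun h => h.primeFactors ⊆ P.primeFactors), (h : ℝ) ^ (-(1 / 2 : ℝ)) ≤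
      (σ 0 P : ℝ) ^ 2 := by
  have h1 := sum_rpow_neg_half_le (S := P.primeFactors) (fun p hp => Nat.prime_of_mem_primeFactors hp)
    ((Icc 1 B).filter (fun h => h.primeFactors ⊆ P.primeFactors)) (fun r hr => by
      simp only [Finset.mem_filter, Finset.mem_Icc] at hr
      exact ⟨by omega, hr.2⟩)
  refine h1.trans ?_
  have h2 : ((2 ^ P.primeFactors.card : ℕ) : ℝ) ≤ (σ 0 P : ℝ) := by
    exact_mod_cast two_pow_card_primeFactors_le hP
  calc (4 : ℝ) ^ P.primeFactors.card = (((2 ^ P.primeFactors.card : ℕ) : ℝ)) ^ 2 := by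
        push_cast
        rw [← pow_mul, mul_comm, pow_mul]
        norm_num
    _ ≤ (σ 0 P : ℝ) ^ 2 := by gcongr

end Drappeau2017

end Literature.NumberTheory.Sieve

end
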